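import Mathlib.RingTheory.Filtration
import Mathlib.LinearAlgebra.Dual.Lemmas
import Mathlib.Algebra.Module.SpanRankOperations
import Literature.RingTheory.CompleteLocalRings.CotangentPresentation
import Literature.AlgebraicGeometry.Resolution.FormalNormalCrossingsLemmas
import HarnessLib

/-!
# Counting relations in a minimal presentation by obstructions
# (Mazur 1989 §1.6 Prop. 2; Böckle Thm. 2.2 (d) and the surjection `H²(Π, ad)^* ↠ J/𝔪J`)

Topic `Literature/RingTheory/CompleteLocalRings`.  Let `Λ` be a local ring and `F` a local
`Λ`-algebra with `𝔪_Λ F ⊆ 𝔪_F` (in the application `F = Λ⟦X₁, …, X_h⟧`), and let `R = F/J` be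
presented MINIMALLY, i.e. `J ⊆ 𝔪_F² + 𝔪_Λ F` (the variables map onto a basis of the relative
cotangent space `𝔪_R/(𝔪_R² + 𝔪_Λ R)`, dual to Mazur's tangent space `t_R`).  Mazur's bound
"the minimal number of generators of `J` is at most `dim H²`" ([Maz89, §1.6 Prop. 2]; [Böc07,
Thm. 2.2 (d)] with the canonical surjection (1) `H²(Π, ad ρ̄)^* ↠ J/𝔪_F J`) has a purely
ring-theoretic half and a deformation-theoretic half.  The deformation-theoretic half produces,
for the small extension `F/(𝔪_F J + 𝔪_F^n) ↠ F/(J + 𝔪_F^n) = R/𝔪_R^n`, an obstruction class, linear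
in the functional `u` on its kernel `J/(𝔪_F J + J ∩ 𝔪_F^n)` along which one pushes out, whose
vanishing makes the pushed-out extension `F/(J_u + 𝔪_F^n) ↠ R/𝔪_R^n` SPLIT (the universal
deformation lifts, and universality gives the section).  This file PROVES the ring-theoretic
half, for any local `Λ`-algebra:

* `sup_le_sup_of_section` — **no split small extensions inside a minimal presentation**: if
  `J ⊆ 𝔪_F² + 𝔪_Λ F`, `𝔞 ⊆ 𝔪_F²`, `𝔪_F J ⊆ J'` and the surjection `F/(J' + 𝔞) ↠ F/(J + 𝔞)` has a
  `Λ`-algebra section, then `J + 𝔞 ⊆ J' + 𝔞` (the difference of the two structure maps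
  `F → F/(J' + 𝔞)` is a derivation into the square-zero kernel, hence kills `𝔪_F² + 𝔪_Λ F`);
* `exists_inf_pow_le_mul` — Artin–Rees: `J ∩ 𝔪_F^n ⊆ 𝔪_F J` for some `n ≥ 2`, so that
  `J/𝔪_F J = J/(𝔪_F J + J ∩ 𝔪_F^n)` is the kernel of an extension of ARTINIAN quotients;
* `Obstructed.eq_zero_of_section`, `spanFinrank_le_finrank_of_obstruction` — **Mazur's count**:
  if a `k`-linear map `ob` on the dual of `J/𝔪_F J` (`k = F/𝔪_F`) into a `k`-vector space `O`
  has the property that `ob u = 0` forces the extension pushed out along `u` to split, then `ob`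
  is injective and `gen(J) = dim_k J/𝔪_F J ≤ dim_k O`;
* `exists_mvPowerSeries_algHom_surjective_minimal` — the cotangent presentation of a complete
  Noetherian local `Λ`-algebra `C` by `h = dim_k 𝔪_C/(𝔪_C² + 𝔪_Λ C)` variables
  (`CotangentPresentation.lean`) can be chosen MINIMAL: `ker ⊆ 𝔪² + 𝔪_Λ Λ⟦X⟧` (Nakayama: a
  relation with a unit linear coefficient would make one generator of `𝔪_{C/𝔪_Λ C}` redundant).

## References

* B. Mazur, *Deforming Galois representations*, in Galois groups over `ℚ`, MSRI Publ. 16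
  (1989), §1.6, Prop. 2. [cite: Mazur1989Deforming, §1.6 Prop. 2]
* G. Böckle, *Presentations of universal deformation rings*, LMS LNS 320 (2007), Thm. 2.2 (d)
  and (1). [cite: Bockle2007Presentations, Theorem 2.2]
* H. Matsumura, *Commutative Ring Theory*, CUP 1986, Thm. 8.4 (and Thm. 8.5, Artin–Rees).
  [cite: Matsumura1987, Thm. 8.4]
-/

noncomputable section

namespace Literature.RingTheory.CompleteLocalRings

universe u

open IsLocalRing

/-! ## 1. No split small extensions inside a minimal presentation -/

section NoSection

variable {Λ : Type*} [CommRing Λ] [IsLocalRing Λ] {F : Type*} [CommRing F] [IsLocalRing F]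
  [Algebra Λ F]

/-- **No split small extensions inside a minimal presentation** (the ring-theoretic heart of
Mazur's relation count).  Let `F` be a local `Λ`-algebra with `𝔪_Λ F ⊆ 𝔪_F`, `J ⊆ 𝔪_F² + 𝔪_Λ F`
("minimal presentation" of `F/J`), `𝔞 ⊆ 𝔪_F²` (e.g. `𝔞 = 𝔪_F^n`, `n ≥ 2`, or `𝔞 = 0`) and
`J' ⊇ 𝔪_F J` with `J' + 𝔞 ⊆ J + 𝔞`.  If the surjection `F/(J' + 𝔞) ↠ F/(J + 𝔞)` admits a
`Λ`-algebra section, then `J + 𝔞 ⊆ J' + 𝔞` (so the extension was trivial).  Proof: with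
`β : F → F/(J' + 𝔞)` the quotient map and `σ` the section composed with `F → F/(J + 𝔞)`, the
difference `δ = β − σ` takes values in the kernel `Ī`, which satisfies `Ī · β(𝔪_F) = 0`; hence
`δ(fg) = β(f)δ(g) + δ(f)σ(g) = 0` for `f, g ∈ 𝔪_F` and `δ(λf) = λδ(f) = 0` for `λ ∈ 𝔪_Λ`, so `δ`
kills `𝔪_F² + 𝔪_Λ F ⊇ J + 𝔞`, on which `σ` vanishes too. [cite: Mazur1989Deforming, §1.6 Prop. 2] -/
theorem sup_le_sup_of_section (hΛ : (maximalIdeal Λ).map (algebraMap Λ F) ≤ maximalIdeal F)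
    {J J' 𝔞 : Ideal F} (hJ : J ≤ maximalIdeal F ^ 2 ⊔ (maximalIdeal Λ).map (algebraMap Λ F))
    (h𝔞 : 𝔞 ≤ maximalIdeal F ^ 2) (hJ' : maximalIdeal F * J ≤ J') (hle : J' ⊔ 𝔞 ≤ J ⊔ 𝔞)
    (s : (F ⧸ (J ⊔ 𝔞)) →ₐ[Λ] (F ⧸ (J' ⊔ 𝔞)))
    (hs : (Ideal.Quotient.factorₐ Λ hle).comp s = AlgHom.id Λ _) :
    J ⊔ 𝔞 ≤ J' ⊔ 𝔞 := by
  have h2 : maximalIdeal F ^ 2 ≤ maximalIdeal F := Ideal.pow_le_self two_ne_zero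
  have hC : J ⊔ 𝔞 ≤ maximalIdeal F := sup_le (hJ.trans (sup_le h2 hΛ)) (h𝔞.trans h2)
  -- the two structure maps `F → B := F/(J' + 𝔞)`
  let β : F →ₐ[Λ] F ⧸ (J' ⊔ 𝔞) := Ideal.Quotient.mkₐ Λ (J' ⊔ 𝔞)
  let σ : F →ₐ[Λ] F ⧸ (J' ⊔ 𝔞) := s.comp (Ideal.Quotient.mkₐ Λ (J ⊔ 𝔞))
  have hβ : ∀ x, β x = 0 ↔ x ∈ J' ⊔ 𝔞 := fun x => Ideal.Quotient.eq_zero_iff_mem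
  -- `σ` vanishes on `J + 𝔞`
  have hσ : ∀ x ∈ J ⊔ 𝔞, σ x = 0 := fun x hx => by
    change s (Ideal.Quotient.mk (J ⊔ 𝔞) x) = 0
    rw [Ideal.Quotient.eq_zero_iff_mem.mpr hx, map_zero]
  -- the kernel `Ī = β(J + 𝔞)` is killed by `β(𝔪_F)`
  have hB : ∀ y ∈ J ⊔ 𝔞, ∀ m ∈ maximalIdeal F, β (y * m) = 0 := by
    intro y hy m hm
    rw [hβ]
    obtain ⟨j, hj, a, ha, rfl⟩ := Submodule.mem_sup.mp hy
    rw [add_mul]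
    exact Ideal.add_mem _ (Ideal.mem_sup_left (hJ' (Ideal.mul_mem_mul_rev hm hj)))
      (Ideal.mem_sup_right (Ideal.mul_mem_right _ _ ha))
  -- `δ = β − σ` takes values in `Ī`
  have hA : ∀ f, ∃ y ∈ J ⊔ 𝔞, β f - σ f = β y := by
    intro f
    obtain ⟨g, hg⟩ := Ideal.Quotient.mk_surjective (s (Ideal.Quotient.mk (J ⊔ 𝔞) f))
    have h1 : Ideal.Quotient.mk (J ⊔ 𝔞) g = Ideal.Quotient.mk (J ⊔ 𝔞) f := by
      have h3 : (Ideal.Quotient.factorₐ Λ hle) (s (Ideal.Quotient.mk (J ⊔ 𝔞) f)) =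
          Ideal.Quotient.mk (J ⊔ 𝔞) f := by
        change ((Ideal.Quotient.factorₐ Λ hle).comp s) _ = _
        rw [hs, AlgHom.id_apply]
      rw [← hg] at h3
      exact h3
    refine ⟨f - g, ?_, ?_⟩
    · rw [← Ideal.Quotient.mk_eq_mk_iff_sub_mem]
      exact h1.symm
    · change Ideal.Quotient.mk (J' ⊔ 𝔞) f - s (Ideal.Quotient.mk (J ⊔ 𝔞) f) =
        Ideal.Quotient.mk (J' ⊔ 𝔞) (f - g)
      rw [map_sub, hg]
  -- `δ` kills products of two elements of `𝔪_F`
  have hD : ∀ f ∈ maximalIdeal F, ∀ g ∈ maximalIdeal F, β (f * g) - σ (f * g) = 0 := by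
    intro f hf g hg
    obtain ⟨yf, hyf, hdf⟩ := hA f
    obtain ⟨yg, hyg, hdg⟩ := hA g
    have hσg : σ g = β g - β yg := by rw [← hdg]; ring
    have hσf : σ f = β f - β yf := by rw [← hdf]; ring
    rw [map_mul, map_mul, hσf, hσg]
    have e1 : β f * β g - (β f - β yf) * (β g - β yg) =
        β (yg * f) + β (yf * g) - β (yf * yg) := by
      simp only [map_mul]; ring
    rw [e1, hB yg hyg f hf, hB yf hyf g hg, hB yf hyf yg (hC hyg)]
    ring
  -- `δ` kills `𝔪_Λ F` (it is `Λ`-linear)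
  have hE : ∀ z ∈ (maximalIdeal Λ).map (algebraMap Λ F), ∀ r : F, β (r * z) - σ (r * z) = 0 := by
    intro z hz
    refine Submodule.span_induction (p := fun z _ => ∀ r : F, β (r * z) - σ (r * z) = 0)
      ?_ ?_ ?_ ?_ hz
    · rintro _ ⟨l, hl, rfl⟩ r
      obtain ⟨y, hy, hdy⟩ := hA r
      have e1 : r * algebraMap Λ F l = l • r := by rw [Algebra.smul_def, mul_comm]
      rw [e1, map_smul, map_smul, ← smul_sub, hdy, ← map_smul, Algebra.smul_def, mul_comm]
      exact hB y hy _ (hΛ (Ideal.mem_map_of_mem _ hl))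
    · intro r
      rw [mul_zero, map_zero, map_zero, sub_zero]
    · intro x y _ _ hx hy r
      rw [mul_add, map_add, map_add]
      rw [show β (r * x) + β (r * y) - (σ (r * x) + σ (r * y)) =
        (β (r * x) - σ (r * x)) + (β (r * y) - σ (r * y)) by ring, hx r, hy r, add_zero]
    · intro a x _ hx r
      rw [smul_eq_mul, ← mul_assoc]
      exact hx (r * a)
  -- hence `δ` kills `𝔪_F² + 𝔪_Λ F ⊇ J + 𝔞`, where `σ` vanishes: so does `β`
  intro x hx
  rw [← hβ]
  have hx' : x ∈ maximalIdeal F ^ 2 ⊔ (maximalIdeal Λ).map (algebraMap Λ F) :=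
    (sup_le hJ (h𝔞.trans le_sup_left)) hx
  obtain ⟨y, hy, z, hz, rfl⟩ := Submodule.mem_sup.mp hx'
  have hδy : β y - σ y = 0 := by
    rw [pow_two] at hy
    refine Submodule.mul_induction_on hy (fun f hf g hg => hD f hf g hg) ?_
    intro a b ha hb
    rw [map_add, map_add, show β a + β b - (σ a + σ b) = (β a - σ a) + (β b - σ b) by ring,
      ha, hb, add_zero]
  have hδz : β z - σ z = 0 := by simpa using hE z hz 1
  have e : β (y + z) = (β y - σ y) + (β z - σ z) + σ (y + z) := by rw [map_add, map_add]; ring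
  rw [e, hδy, hδz, hσ _ hx, zero_add, add_zero]

end NoSection

/-! ## 2. Artin–Rees: the Artinian level seeing all of `J/𝔪J` -/

section ArtinRees

variable {F : Type*} [CommRing F] [IsLocalRing F] [IsNoetherianRing F]

/-- **`J ∩ 𝔪^n ⊆ 𝔪J` for some `n ≥ 2`** (Artin–Rees, Mathlib `Ideal.exists_pow_inf_eq_pow_smul`):
then `J/𝔪_F J → (J + 𝔪^n)/(𝔪J + 𝔪^n)` is an isomorphism, i.e. the minimal number of generators of
`J` is visible in the Artinian quotient `F/𝔪^n`. [cite: Matsumura1987, Thm. 8.4] -/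
theorem exists_inf_pow_le_mul (J : Ideal F) :
    ∃ n, 2 ≤ n ∧ J ⊓ maximalIdeal F ^ n ≤ maximalIdeal F * J := by
  obtain ⟨c, hc⟩ := (maximalIdeal F).exists_pow_inf_eq_pow_smul J
  refine ⟨c + 2, by omega, ?_⟩
  have h := hc (c + 2) (by omega)
  simp only [smul_eq_mul, Ideal.mul_top, Nat.add_sub_cancel_left] at h
  rw [inf_comm, h]
  calc maximalIdeal F ^ 2 * (maximalIdeal F ^ c ⊓ J)
      ≤ maximalIdeal F * J :=
        Ideal.mul_mono (Ideal.pow_le_self two_ne_zero) inf_le_right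

end ArtinRees

/-! ## 3. Mazur's count: `gen(J) ≤ dim O` -/

section Count

variable {Λ : Type*} [CommRing Λ] [IsLocalRing Λ] {F : Type*} [CommRing F] [IsLocalRing F]
  [Algebra Λ F]

/-- The ideal `J_u = {x ∈ J | u [x] = 0}` cut out of `J` by a functional `u` on `J/𝔪_F J`
(`k = F/𝔪_F`-linear): the pushout of the extension `F/𝔪_F J ↠ F/J` along `u` is
`F/J_u ↠ F/J`, with kernel `J/J_u ≅ k` when `u ≠ 0`. [cite: Mazur1989Deforming, §1.6 Prop. 2] -/
def pushoutIdeal (J : Ideal F)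
    (u : Module.Dual (F ⧸ maximalIdeal F) (J ⧸ (maximalIdeal F • (⊤ : Submodule F J)))) :
    Ideal F where
  carrier := {x | ∃ hx : x ∈ J, u (Submodule.Quotient.mk ⟨x, hx⟩) = 0}
  zero_mem' := ⟨J.zero_mem, by
    rw [show (⟨0, J.zero_mem⟩ : J) = 0 from rfl, Submodule.Quotient.mk_zero, map_zero]⟩
  add_mem' := by
    rintro x y ⟨hx, hux⟩ ⟨hy, huy⟩
    refine ⟨J.add_mem hx hy, ?_⟩
    rw [show (⟨x + y, J.add_mem hx hy⟩ : J) = ⟨x, hx⟩ + ⟨y, hy⟩ from rfl,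
      Submodule.Quotient.mk_add, map_add, hux, huy, add_zero]
  smul_mem' := by
    rintro c x ⟨hx, hux⟩
    refine ⟨J.smul_mem c hx, ?_⟩
    rw [show (⟨c • x, J.smul_mem c hx⟩ : J) = c • ⟨x, hx⟩ from rfl,
      ← Module.Quotient.mk_smul_mk, map_smul, hux, smul_zero]

/-- `J_u ⊆ J`. [folklore] -/
theorem pushoutIdeal_le (J : Ideal F)
    (u : Module.Dual (F ⧸ maximalIdeal F) (J ⧸ (maximalIdeal F • (⊤ : Submodule F J)))) :
    pushoutIdeal J u ≤ J := fun _ ⟨hx, _⟩ => hx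

/-- `𝔪_F J ⊆ J_u` (the functional lives on `J/𝔪_F J`). [folklore] -/
theorem maximalIdeal_mul_le_pushoutIdeal (J : Ideal F)
    (u : Module.Dual (F ⧸ maximalIdeal F) (J ⧸ (maximalIdeal F • (⊤ : Submodule F J)))) :
    maximalIdeal F * J ≤ pushoutIdeal J u := by
  refine Ideal.mul_le.mpr fun m hm j hj => ⟨J.mul_mem_left m hj, ?_⟩
  have h0 : (Submodule.Quotient.mk (⟨m * j, J.mul_mem_left m hj⟩ : J) :
      J ⧸ (maximalIdeal F • (⊤ : Submodule F J))) = 0 := by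
    rw [Submodule.Quotient.mk_eq_zero]
    exact Submodule.smul_mem_smul hm (Submodule.mem_top : (⟨j, hj⟩ : J) ∈ ⊤)
  rw [h0, map_zero]

/-- Membership in `J_u`. [folklore] -/
theorem mem_pushoutIdeal_iff (J : Ideal F)
    (u : Module.Dual (F ⧸ maximalIdeal F) (J ⧸ (maximalIdeal F • (⊤ : Submodule F J))))
    (x : J) : (x : F) ∈ pushoutIdeal J u ↔ u (Submodule.Quotient.mk x) = 0 :=
  ⟨fun ⟨_, h⟩ => h, fun h => ⟨x.2, h⟩⟩

/-- **A functional whose pushout splits is zero.**  With `J ⊆ 𝔪_F² + 𝔪_Λ F` minimal, `n ≥ 2` such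
that `J ∩ 𝔪_F^n ⊆ 𝔪_F J` (`exists_inf_pow_le_mul`), and `u` a functional on `J/𝔪_F J`: if the small
extension of Artinian-level quotients `F/(J_u + 𝔪_F^n) ↠ F/(J + 𝔪_F^n)` has a `Λ`-algebra section,
then `u = 0` (by `sup_le_sup_of_section`, `J ⊆ J_u + 𝔪_F^n`, and `J ∩ 𝔪_F^n` dies in `J/𝔪_F J`).
[cite: Mazur1989Deforming, §1.6 Prop. 2] -/
theorem eq_zero_of_section (hΛ : (maximalIdeal Λ).map (algebraMap Λ F) ≤ maximalIdeal F)
    {J : Ideal F} (hJ : J ≤ maximalIdeal F ^ 2 ⊔ (maximalIdeal Λ).map (algebraMap Λ F))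
    {n : ℕ} (hn : 2 ≤ n) (hJn : J ⊓ maximalIdeal F ^ n ≤ maximalIdeal F * J)
    (u : Module.Dual (F ⧸ maximalIdeal F) (J ⧸ (maximalIdeal F • (⊤ : Submodule F J))))
    (s : (F ⧸ (J ⊔ maximalIdeal F ^ n)) →ₐ[Λ] (F ⧸ (pushoutIdeal J u ⊔ maximalIdeal F ^ n)))
    (hs : (Ideal.Quotient.factorₐ Λ
        (sup_le_sup_right (pushoutIdeal_le J u) (maximalIdeal F ^ n))).comp s =
      AlgHom.id Λ _) :
    u = 0 := by
  have hpow : maximalIdeal F ^ n ≤ maximalIdeal F ^ 2 := Ideal.pow_le_pow_right hn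
  have hsec := sup_le_sup_of_section hΛ hJ hpow (maximalIdeal_mul_le_pushoutIdeal J u)
    (sup_le_sup_right (pushoutIdeal_le J u) _) s hs
  refine LinearMap.ext fun v => ?_
  obtain ⟨x, rfl⟩ := Submodule.Quotient.mk_surjective _ v
  rw [LinearMap.zero_apply]
  have hxJ : (x : F) ∈ pushoutIdeal J u ⊔ maximalIdeal F ^ n := hsec (Ideal.mem_sup_left x.2)
  obtain ⟨a, ha, b, hb, hab⟩ := Submodule.mem_sup.mp hxJ
  have hbJ : b ∈ J := by
    have e : b = x - a := by rw [← hab]; ring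
    rw [e]
    exact J.sub_mem x.2 (pushoutIdeal_le J u ha)
  have hb0 : (Submodule.Quotient.mk (⟨b, hbJ⟩ : J) : J ⧸ (maximalIdeal F • (⊤ : Submodule F J))) =
      0 := by
    rw [Submodule.Quotient.mk_eq_zero]
    have hb' : b ∈ maximalIdeal F * J := hJn ⟨hbJ, hb⟩
    -- `𝔪 * J` is the image of `𝔪 • ⊤ ⊆ J` in `F`
    have hmap : (maximalIdeal F • (⊤ : Submodule F J)).map J.subtype = maximalIdeal F * J := by
      rw [Submodule.map_smul'', Submodule.map_top, Submodule.range_subtype, Ideal.smul_eq_mul]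
    rw [← hmap] at hb'
    obtain ⟨y, hy, hyb⟩ := Submodule.mem_map.mp hb'
    have e : (⟨b, hbJ⟩ : J) = y := Subtype.ext (by simpa using hyb.symm)
    rwa [e]
  have ha' : u (Submodule.Quotient.mk ⟨a, pushoutIdeal_le J u ha⟩) = 0 :=
    (mem_pushoutIdeal_iff J u ⟨a, _⟩).mp ha
  have e : x = ⟨a, pushoutIdeal_le J u ha⟩ + ⟨b, hbJ⟩ := Subtype.ext hab.symm
  rw [e, Submodule.Quotient.mk_add, map_add, ha', hb0, map_zero, add_zero]

/-- **Mazur's relation count** ([Maz89, §1.6 Prop. 2]: "the minimal number of generators of `J`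
is `≤ dim H²`"; [Böc07, Thm. 2.2 (d)] via the surjection (1) `H²(Π, ad ρ̄)^* ↠ J/𝔪J`), abstract
form.  Let `F/J` be minimally presented (`J ⊆ 𝔪_F² + 𝔪_Λ F`, `F` Noetherian local), `n ≥ 2` with
`J ∩ 𝔪_F^n ⊆ 𝔪_F J`, and let `ob` be a `k`-linear map from the dual of `J/𝔪_F J` to a
finite-dimensional `k`-vector space `O` (`k = F/𝔪_F`; in the application `O` is an `H²` and
`ob u` the obstruction class of the extension pushed out along `u`) such that `ob u = 0` implies
that `F/(J_u + 𝔪_F^n) ↠ F/(J + 𝔪_F^n)` has a `Λ`-algebra section.  Then `ob` is injective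
(`eq_zero_of_section`) and `gen(J) = dim_k J/𝔪_F J ≤ dim_k O`. [cite: Mazur1989Deforming, §1.6 Prop. 2]
[cite: Bockle2007Presentations, Theorem 2.2] -/
theorem spanFinrank_le_finrank_of_obstruction [IsNoetherianRing F]
    (hΛ : (maximalIdeal Λ).map (algebraMap Λ F) ≤ maximalIdeal F)
    {J : Ideal F} (hJ : J ≤ maximalIdeal F ^ 2 ⊔ (maximalIdeal Λ).map (algebraMap Λ F))
    {n : ℕ} (hn : 2 ≤ n) (hJn : J ⊓ maximalIdeal F ^ n ≤ maximalIdeal F * J)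
    {O : Type*} [AddCommGroup O] [Module (F ⧸ maximalIdeal F) O]
    [Module.Finite (F ⧸ maximalIdeal F) O]
    (ob : Module.Dual (F ⧸ maximalIdeal F) (J ⧸ (maximalIdeal F • (⊤ : Submodule F J)))
      →ₗ[F ⧸ maximalIdeal F] O)
    (hob : ∀ u, ob u = 0 →
      ∃ s : (F ⧸ (J ⊔ maximalIdeal F ^ n)) →ₐ[Λ] (F ⧸ (pushoutIdeal J u ⊔ maximalIdeal F ^ n)),
        (Ideal.Quotient.factorₐ Λ
            (sup_le_sup_right (pushoutIdeal_le J u) (maximalIdeal F ^ n))).comp s =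
          AlgHom.id Λ _) :
    J.spanFinrank ≤ Module.finrank (F ⧸ maximalIdeal F) O := by
  have hinj : Function.Injective ob := by
    rw [← LinearMap.ker_eq_bot, LinearMap.ker_eq_bot']
    intro u hu
    obtain ⟨s, hs⟩ := hob u hu
    exact eq_zero_of_section hΛ hJ hn hJn u s hs
  haveI : Module.Finite (F ⧸ maximalIdeal F) (J ⧸ (maximalIdeal F • (⊤ : Submodule F J))) :=
    Module.Finite.of_restrictScalars_finite F _ _
  letI : Field (F ⧸ maximalIdeal F) := Ideal.Quotient.field (maximalIdeal F)
  rw [IsLocalRing.spanFinrank_eq_finrank_quotient J (IsNoetherian.noetherian J)]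
  calc Module.finrank (F ⧸ maximalIdeal F) (J ⧸ (maximalIdeal F • (⊤ : Submodule F J)))
      = Module.finrank (F ⧸ maximalIdeal F)
          (Module.Dual (F ⧸ maximalIdeal F) (J ⧸ (maximalIdeal F • (⊤ : Submodule F J)))) :=
        Subspace.dual_finrank_eq.symm
    _ ≤ Module.finrank (F ⧸ maximalIdeal F) O := LinearMap.finrank_le_finrank_of_injective hinj

end Count

/-! ## 4. The minimal cotangent presentation -/

section Minimal

variable {Λ : Type u} [CommRing Λ] [IsLocalRing Λ] {C : Type u} [CommRing C] [IsLocalRing C]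
  [Algebra Λ C]

/-- A surjection onto a local ring from a local ring maps the maximal ideal into the maximal
ideal (if `Θ(m)` were a unit, `Θ(m w) = 1` for some `w` and `Θ(1 − m w) = 0` would be a unit).
[folklore] -/
theorem map_maximalIdeal_le_of_surjective {P : Type*} [CommRing P] [IsLocalRing P]
    (Θ : P →+* C) (hΘ : Function.Surjective Θ) : (maximalIdeal P).map Θ ≤ maximalIdeal C := by
  rw [Ideal.map_le_iff_le_comap]
  intro m hm
  rw [Ideal.mem_comap]
  by_contra hu
  have hunit : IsUnit (Θ m) := by
    by_contra h
    exact hu h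
  obtain ⟨w, hw⟩ := hΘ ((hunit.unit⁻¹ : Cˣ) : C)
  have h1 : Θ (m * w) = 1 := by rw [map_mul, hw, IsUnit.mul_val_inv]
  have h2 : IsUnit (1 - m * w) :=
    IsLocalRing.isUnit_one_sub_self_of_mem_nonunits _ ((maximalIdeal P).mul_mem_right w hm)
  have h3 : IsUnit (Θ (1 - m * w)) := h2.map Θ
  rw [map_sub, map_one, h1, sub_self] at h3
  exact not_isUnit_zero h3

/-- A power series over a local ring lies in the maximal ideal iff its constant coefficient does.
[folklore] -/
theorem mem_maximalIdeal_mvPowerSeries_iff' {σ : Type*} (f : MvPowerSeries σ Λ) :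
    f ∈ maximalIdeal (MvPowerSeries σ Λ) ↔ MvPowerSeries.constantCoeff f ∈ maximalIdeal Λ := by
  rw [mem_maximalIdeal, mem_maximalIdeal, mem_nonunits_iff, mem_nonunits_iff,
    MvPowerSeries.isUnit_iff_constantCoeff]

variable [IsNoetherianRing C]

/-- **The minimal cotangent presentation** (Mazur; Böckle Thm. 2.2 (c)–(d): "`R ≅ 𝒪[[T₁, …, T_h]]/J`,
`h = dim_k t_R`", the `Tᵢ` mapping onto a BASIS of the relative cotangent space).  With
`Λ → C` a local homomorphism of complete local rings, `C` Noetherian, inducing a surjection on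
residue fields, and `h = μ(𝔪_{C/𝔪_Λ C})`, there is a surjective `Λ`-algebra map
`Θ : Λ⟦X₁, …, X_h⟧ ↠ C` with the variables mapping into `𝔪_C` whose kernel is contained in
`𝔪² + 𝔪_Λ Λ⟦X⟧`: send `Xᵢ` to lifts `xᵢ` of a minimal generating set of `𝔪_{C/𝔪_Λ C}`; a relation
`j ≡ Σ λᵢ Xᵢ (mod 𝔪² + 𝔪_Λ)` with a unit `λ_{i₀}` would give `x̄_{i₀} ∈ (x̄ᵢ : i ≠ i₀) + 𝔪̄²`, and by
Nakayama `𝔪_{C/𝔪_Λ C}` would be generated by `h − 1` elements.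
[cite: Bockle2007Presentations, Theorem 2.2] [cite: Matsumura1987, Thm. 8.4] -/
theorem exists_mvPowerSeries_algHom_surjective_minimal
    [IsAdicComplete (maximalIdeal Λ) Λ] [IsAdicComplete (maximalIdeal C) C]
    [IsLocalHom (algebraMap Λ C)]
    (hres : ∀ c : C, ∃ l : Λ, c - algebraMap Λ C l ∈ maximalIdeal C) :
    ∃ Θ : MvPowerSeries
        (Fin ((maximalIdeal C).map
          (Ideal.Quotient.mk ((maximalIdeal Λ).map (algebraMap Λ C)))).spanFinrank) Λ →ₐ[Λ] C,
      Function.Surjective Θ ∧ (∀ i, Θ (MvPowerSeries.X i) ∈ maximalIdeal C) ∧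
        RingHom.ker Θ ≤ maximalIdeal _ ^ 2 ⊔ (maximalIdeal Λ).map (algebraMap Λ _) := by
  classical
  set J₀ : Ideal C := (maximalIdeal Λ).map (algebraMap Λ C) with hJ₀
  set π : C →+* C ⧸ J₀ := Ideal.Quotient.mk J₀ with hπ
  set M : Ideal (C ⧸ J₀) := (maximalIdeal C).map π with hM
  -- a minimal generating set of `M = 𝔪_{C/𝔪_Λ C}`
  have hMfg : M.FG := Ideal.FG.map (IsNoetherian.noetherian _) π
  obtain ⟨s, hscard, hsspan⟩ := Submodule.FG.exists_span_finset_card_eq_spanFinrank hMfg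
  set h := M.spanFinrank with hh
  let e : Fin h ≃ s := (s.equivFinOfCardEq hscard).symm
  let f : Fin h → C ⧸ J₀ := fun i => (e i : C ⧸ J₀)
  have hfs : ∀ i, f i ∈ s := fun i => (e i).2
  have hfrange : Set.range f = (s : Set (C ⧸ J₀)) := by
    ext z
    constructor
    · rintro ⟨i, rfl⟩
      exact hfs i
    · intro hz
      exact ⟨e.symm ⟨z, hz⟩, by simp [f]⟩
  have hfspan : Ideal.span (Set.range f) = M := by rw [hfrange]; exact hsspan
  -- lift the generators to `𝔪_C`
  have hsub : ∀ i, f i ∈ M := fun i => by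
    rw [← hfspan]
    exact Ideal.subset_span ⟨i, rfl⟩
  have hlift : ∀ i, ∃ y ∈ maximalIdeal C, π y = f i := fun i => by
    have hi := hsub i
    rw [hM, Ideal.mem_map_iff_of_surjective π Ideal.Quotient.mk_surjective] at hi
    obtain ⟨y, hy, hyi⟩ := hi
    exact ⟨y, hy, hyi⟩
  choose x hxm hxf using hlift
  have hgen : maximalIdeal C ≤ Ideal.span (Set.range x) ⊔ J₀ ⊔ maximalIdeal C ^ 2 := by
    intro m hm
    refine Ideal.mem_sup_left ?_
    have h1 : π m ∈ (Ideal.span (Set.range x)).map π := by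
      have h2 : π m ∈ M := Ideal.mem_map_of_mem _ hm
      rw [← hfspan] at h2
      rw [Ideal.map_span, ← Set.range_comp]
      have h3 : Set.range (⇑π ∘ x) = Set.range f := by
        ext z
        simp only [Set.mem_range, Function.comp_apply, hxf]
      rw [h3]
      exact h2
    rw [Ideal.mem_map_iff_of_surjective π Ideal.Quotient.mk_surjective] at h1
    obtain ⟨y, hy, hym⟩ := h1
    have h4 : m - y ∈ J₀ := by
      rw [← Ideal.Quotient.mk_eq_mk_iff_sub_mem]
      exact hym.symm
    have h5 : m = y + (m - y) := by ring
    rw [h5]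
    exact Ideal.add_mem _ (Ideal.mem_sup_left hy) (Ideal.mem_sup_right h4)
  obtain ⟨Θ, hsurj, hΘX⟩ := exists_mvPowerSeries_algHom_surjective_of_le_sup_sq hres x hxm hgen
  refine ⟨Θ, hsurj, fun i => (hΘX i).symm ▸ hxm i, ?_⟩
  -- minimality
  set P := MvPowerSeries (Fin h) Λ
  have hΘm : (maximalIdeal P).map (Θ : P →+* C) ≤ maximalIdeal C :=
    map_maximalIdeal_le_of_surjective (Θ : P →+* C) hsurj
  have hΘC : ∀ l : Λ, Θ (MvPowerSeries.C l) = algebraMap Λ C l := fun l => by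
    rw [show (MvPowerSeries.C l : P) = algebraMap Λ P l by
      rw [MvPowerSeries.algebraMap_apply, Algebra.algebraMap_self, RingHom.id_apply]]
    exact Θ.commutes l
  have hJ₀m : J₀ ≤ maximalIdeal C := by
    rw [hJ₀, Ideal.map_le_iff_le_comap]
    intro l hl
    rw [Ideal.mem_comap]
    exact map_nonunit (algebraMap Λ C) l hl
  intro j hj
  rw [RingHom.mem_ker] at hj
  -- `j ∈ 𝔪_P`
  have hjm : j ∈ maximalIdeal P := by
    by_contra hju
    have hu : IsUnit j := by
      by_contra h
      exact hju h
    have := hu.map Θ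
    rw [hj] at this
    exact not_isUnit_zero this
  have hc₀ : MvPowerSeries.constantCoeff j ∈ maximalIdeal Λ :=
    (mem_maximalIdeal_mvPowerSeries_iff' j).mp hjm
  -- `j - C(j₀) = Σ gᵢ Xᵢ`
  have hjX : j - MvPowerSeries.C (MvPowerSeries.constantCoeff j) ∈
      Ideal.span (Set.range (MvPowerSeries.X : Fin h → P)) :=
    Literature.AlgebraicGeometry.Resolution.MvPowerSeries.mem_span_range_X_of_constantCoeff_eq_zero
      (by simp)
  obtain ⟨g, hg⟩ := Ideal.mem_span_range_iff_exists_fun.mp hjX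
  -- the linear part `L = Σ C(λᵢ) Xᵢ`, `λᵢ = gᵢ(0)`
  set lam : Fin h → Λ := fun i => MvPowerSeries.constantCoeff (g i) with hlam
  have hXm : ∀ i, (MvPowerSeries.X i : P) ∈ maximalIdeal P := fun i => by
    rw [mem_maximalIdeal_mvPowerSeries_iff', MvPowerSeries.constantCoeff_X]
    exact zero_mem _
  have hQ : ∑ i, (g i - MvPowerSeries.C (lam i)) * MvPowerSeries.X i ∈ maximalIdeal P ^ 2 := by
    refine Ideal.sum_mem _ fun i _ => ?_
    rw [pow_two]
    refine Ideal.mul_mem_mul ?_ (hXm i)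
    rw [mem_maximalIdeal_mvPowerSeries_iff', map_sub, MvPowerSeries.constantCoeff_C, hlam]
    simp
  have hdecomp : j = MvPowerSeries.C (MvPowerSeries.constantCoeff j) +
      ∑ i, MvPowerSeries.C (lam i) * MvPowerSeries.X i +
      ∑ i, (g i - MvPowerSeries.C (lam i)) * MvPowerSeries.X i := by
    rw [add_assoc, ← Finset.sum_add_distrib]
    have e1 : ∑ i, (MvPowerSeries.C (lam i) * MvPowerSeries.X i +
        (g i - MvPowerSeries.C (lam i)) * MvPowerSeries.X i) = ∑ i, g i * MvPowerSeries.X i :=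
      Finset.sum_congr rfl fun i _ => by ring
    rw [e1, hg]
    ring
  -- it suffices that the linear part lies in `𝔪_P² + 𝔪_Λ P`
  suffices hL : ∑ i, MvPowerSeries.C (lam i) * (MvPowerSeries.X i : P) ∈
      maximalIdeal P ^ 2 ⊔ (maximalIdeal Λ).map (algebraMap Λ P) by
    rw [hdecomp]
    refine Ideal.add_mem _ (Ideal.add_mem _ (Ideal.mem_sup_right ?_) hL) (Ideal.mem_sup_left hQ)
    rw [show (MvPowerSeries.C (MvPowerSeries.constantCoeff j) : P) =
      algebraMap Λ P (MvPowerSeries.constantCoeff j) by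
        rw [MvPowerSeries.algebraMap_apply, Algebra.algebraMap_self, RingHom.id_apply]]
    exact Ideal.mem_map_of_mem _ hc₀
  by_cases hall : ∀ i, lam i ∈ maximalIdeal Λ
  · refine Ideal.mem_sup_right (Ideal.sum_mem _ fun i _ => Ideal.mul_mem_right _ _ ?_)
    rw [show (MvPowerSeries.C (lam i) : P) = algebraMap Λ P (lam i) by
      rw [MvPowerSeries.algebraMap_apply, Algebra.algebraMap_self, RingHom.id_apply]]
    exact Ideal.mem_map_of_mem _ (hall i)
  -- otherwise some `λ_{i₀}` is a unit: contradiction with the minimality of `s`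
  exfalso
  obtain ⟨i₀, hi₀⟩ := not_forall.mp hall
  have hunit : IsUnit (lam i₀) := by
    by_contra h
    exact hi₀ h
  -- apply `Θ`: `Σ λᵢ xᵢ ∈ J₀ + 𝔪_C²`
  have hΘQ : Θ (∑ i, (g i - MvPowerSeries.C (lam i)) * MvPowerSeries.X i) ∈ maximalIdeal C ^ 2 := by
    have h1 : Θ (∑ i, (g i - MvPowerSeries.C (lam i)) * MvPowerSeries.X i) ∈
        (maximalIdeal P ^ 2).map (Θ : P →+* C) := Ideal.mem_map_of_mem _ hQ
    rw [Ideal.map_pow] at h1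
    exact Ideal.pow_right_mono hΘm 2 h1
  have hLC : ∑ i, algebraMap Λ C (lam i) * x i ∈ J₀ ⊔ maximalIdeal C ^ 2 := by
    have h1 : Θ j = algebraMap Λ C (MvPowerSeries.constantCoeff j) +
        ∑ i, algebraMap Λ C (lam i) * x i +
        Θ (∑ i, (g i - MvPowerSeries.C (lam i)) * MvPowerSeries.X i) := by
      conv_lhs => rw [hdecomp]
      rw [map_add, map_add, hΘC, map_sum]
      congr 2
      exact Finset.sum_congr rfl fun i _ => by rw [map_mul, hΘC, hΘX]
    rw [hj] at h1
    have h2 : ∑ i, algebraMap Λ C (lam i) * x i =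
        -(algebraMap Λ C (MvPowerSeries.constantCoeff j)) -
          Θ (∑ i, (g i - MvPowerSeries.C (lam i)) * MvPowerSeries.X i) := by
      rw [eq_sub_iff_add_eq, eq_neg_iff_add_eq_zero, add_comm, ← add_assoc]
      exact h1.symm
    rw [h2]
    exact Ideal.sub_mem _ (Ideal.mem_sup_left (neg_mem (Ideal.mem_map_of_mem _ hc₀)))
      (Ideal.mem_sup_right hΘQ)
  -- push to `C/J₀`: `Σ λᵢ fᵢ ∈ M²`
  have hπJ₀ : ∀ y ∈ J₀ ⊔ maximalIdeal C ^ 2, π y ∈ M ^ 2 := by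
    intro y hy
    obtain ⟨a, ha, b, hb, rfl⟩ := Submodule.mem_sup.mp hy
    rw [map_add, show π a = 0 from Ideal.Quotient.eq_zero_iff_mem.mpr ha, zero_add]
    have h1 : π b ∈ (maximalIdeal C ^ 2).map π := Ideal.mem_map_of_mem _ hb
    rwa [Ideal.map_pow] at h1
  have hsum : ∑ i, π (algebraMap Λ C (lam i)) * f i ∈ M ^ 2 := by
    have h1 := hπJ₀ _ hLC
    rw [map_sum] at h1
    simpa only [map_mul, hxf] using h1
  -- isolate `f i₀`
  set u : C ⧸ J₀ := π (algebraMap Λ C (lam i₀)) with hu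
  have huu : IsUnit u := (hunit.map (algebraMap Λ C)).map π
  set T : Finset (Fin h) := Finset.univ.erase i₀ with hT
  set N : Ideal (C ⧸ J₀) := Ideal.span ((T.image f : Finset (C ⧸ J₀)) : Set (C ⧸ J₀)) with hN
  have hNle : N ≤ M := by
    rw [hN, Ideal.span_le]
    intro z hz
    rw [Finset.mem_coe, Finset.mem_image] at hz
    obtain ⟨i, _, rfl⟩ := hz
    exact hsub i
  have hrest : ∑ i ∈ T, π (algebraMap Λ C (lam i)) * f i ∈ N :=
    Ideal.sum_mem _ fun i hi => Ideal.mul_mem_left _ _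
      (Ideal.subset_span (by
        rw [Finset.mem_coe, Finset.mem_image]
        exact ⟨i, hi, rfl⟩))
  have hfi₀ : f i₀ ∈ N ⊔ M ^ 2 := by
    have hsplit : u * f i₀ + ∑ i ∈ T, π (algebraMap Λ C (lam i)) * f i =
        ∑ i, π (algebraMap Λ C (lam i)) * f i :=
      Finset.add_sum_erase _ (fun i => π (algebraMap Λ C (lam i)) * f i) (Finset.mem_univ i₀)
    have h1 : u * f i₀ ∈ N ⊔ M ^ 2 := by
      have e1 : u * f i₀ = ∑ i, π (algebraMap Λ C (lam i)) * f i -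
          ∑ i ∈ T, π (algebraMap Λ C (lam i)) * f i := by rw [← hsplit]; ring
      rw [e1]
      exact Ideal.sub_mem _ (Ideal.mem_sup_right hsum) (Ideal.mem_sup_left hrest)
    have e2 : f i₀ = ↑(huu.unit⁻¹) * (u * f i₀) := by
      rw [← mul_assoc, IsUnit.val_inv_mul, one_mul]
    rw [e2]
    exact Ideal.mul_mem_left _ _ h1
  -- Nakayama in the local ring `C/J₀`: `M ≤ N`
  have hJ₀ne : J₀ ≠ ⊤ := fun htop =>
    (maximalIdeal.isMaximal C).ne_top (top_le_iff.mp (by rw [← htop]; exact hJ₀m))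
  haveI : Nontrivial (C ⧸ J₀) := Ideal.Quotient.nontrivial_iff.mpr hJ₀ne
  haveI : IsLocalRing (C ⧸ J₀) :=
    IsLocalRing.of_surjective' (Ideal.Quotient.mk J₀) Ideal.Quotient.mk_surjective
  have hMne : M ≠ ⊤ := by
    intro htop
    have h1 : M.comap π = maximalIdeal C := by
      rw [hM, Ideal.comap_map_of_surjective π Ideal.Quotient.mk_surjective]
      refine sup_eq_left.mpr ?_
      intro z hz
      rw [Ideal.mem_comap, Ideal.mem_bot, Ideal.Quotient.eq_zero_iff_mem] at hz
      exact hJ₀m hz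
    rw [htop, Ideal.comap_top] at h1
    exact (maximalIdeal.isMaximal C).ne_top h1.symm
  have hMjac : M ≤ Ideal.jacobson ⊥ :=
    (IsLocalRing.le_maximalIdeal hMne).trans (IsLocalRing.maximalIdeal_le_jacobson ⊥)
  have hMN : M ≤ N := by
    refine Submodule.le_of_le_smul_of_le_jacobson_bot hMfg hMjac ?_
    have hgoal : Ideal.span (Set.range f) ≤ N ⊔ M • M := by
      rw [Ideal.span_le]
      rintro _ ⟨i, rfl⟩
      show f i ∈ N ⊔ M • M
      by_cases hi : i = i₀
      · subst hi
        rw [Ideal.smul_eq_mul, ← pow_two]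
        exact hfi₀
      · refine Ideal.mem_sup_left (Ideal.subset_span ?_)
        rw [Finset.mem_coe, Finset.mem_image]
        exact ⟨i, Finset.mem_erase.mpr ⟨hi, Finset.mem_univ i⟩, rfl⟩
    calc M = Ideal.span (Set.range f) := hfspan.symm
      _ ≤ N ⊔ M • M := hgoal
  -- count generators
  have hMN' : M = N := le_antisymm hMN hNle
  have hcount : M.spanFinrank ≤ h - 1 := by
    calc M.spanFinrank = N.spanFinrank := by rw [hMN']
      _ ≤ ((T.image f : Finset (C ⧸ J₀)) : Set (C ⧸ J₀)).ncard :=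
          Submodule.spanFinrank_span_le_ncard_of_finite (Finset.finite_toSet _)
      _ = (T.image f).card := Set.ncard_coe_finset _
      _ ≤ T.card := Finset.card_image_le
      _ = h - 1 := by
          rw [hT, Finset.card_erase_of_mem (Finset.mem_univ i₀), Finset.card_univ,
            Fintype.card_fin]
  have hpos : 0 < h := Fin.pos i₀
  omega

end Minimal

end Literature.RingTheory.CompleteLocalRings
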